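import Literature.Analysis.FluidPDE.TorusGradientVorticityLp
import HarnessLib

/-!
# Functional mining (K1-Q1/U-explicit, part 1/2): the torus Calderón–Zygmund chain `ω ↦ ∇u ↦ 2S` with the CONSTANT THREADED

Search for candidate a priori estimates; no regularity claim.

Cell `pub-nsfunc`, dict seat (gen 9), STAGED for a prove seat (target tree path
`Summits/NavierStokesRegularity/FunctionalMining/NoGo/StretchingSupExplicitCZ.lean`); typed question
K1-Q1/U-explicit of `HOME/DICTIONARY.md` §14 and `HOME/pub-nsfunc-dict/K1Q1-LADDER.md` §B (v1.18).

WHAT. The tree proves `‖∂ⱼuᵢ‖_p ≤ C ∑ₗ‖ωₗ‖_p` and `‖∂ᵢuⱼ + ∂ⱼuᵢ‖_p ≤ C ∑ₗ‖ωₗ‖_p` on `𝕋³` with an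
EXISTENTIAL constant (`BDSV.exists_eLpNorm_partialDeriv_le_curl`, `BDSV.exists_eLpNorm_twoStrain_le_curl`,
from the periodic Hessian bound `Torus.eLpNorm_hessian_le_laplacian_holds_fin3`, whose constant is
existential). This file re-runs the SAME two proofs with the Hessian constant as a HYPOTHESIS
`hC : ∀ w smooth, ∀ j k, ‖∂ⱼ∂ₖw‖_p ≤ C‖Δw‖_p` and the output constants `2C` and `4C` explicit
(`eLpNorm_partialDeriv_le_curl_of_hessian`, `eLpNorm_twoStrain_le_curl_of_hessian`). Nothing is
asserted about the value of `C`; part 2 (`StretchingSupExplicit`) feeds an explicit literature value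
(`C = p* − 1 = 3` at `p = 4` on `ℝ^d`, every `d`: `‖RⱼRₖ‖_p ≤ p* − 1` (`j ≠ k`) and `‖Rⱼ²‖_p ≤ p* − 1`
— Bañuelos–Méndez-Hernández, Indiana Univ. Math. J. 52 (2003), quoted as eqs. (4)–(5) of
Bañuelos–Bogdan, J. Funct. Anal. 250 (2007) = arXiv:math/0609432 (eq. (34) ibid. re-proves the `j = k`
case; eq. (35) `‖2RⱼRₖ‖_p ≤ p* − 1` is `d = 2` only and is NOT used); de Leeuw transference to `𝕋^d`,
Grafakos 2014 Thm. 4.3.7 — to be typed by the literature seat as a NAMED FACT; referee F27.3)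
into the tree door `stretchingSupBound_of_strainL4Bound`.

The five private lemmas and both proofs below are VERBATIM COPIES of
`Literature/Analysis/FluidPDE/TorusGradientVorticityLp.lean` (lit seat; Majda–Bertozzi 2002 (11.9),
Robinson–Rodrigo–Sadowski 2016 Thm. B.7) with `obtain ⟨C, hC⟩ := …` replaced by the hypothesis; the
private lemmas are copied because they are `private` there. No new mathematics. [folklore]
-/

noncomputable section

open MeasureTheory Set Function
open scoped ENNReal NNReal ContDiff

namespace Summit.NavierStokesRegularity.FunctionalMining

namespace ExplicitCZ

open Literature.Analysis.FunctionSpaces Literature.Analysis.FunctionSpaces.Torus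
open Literature.Analysis.FluidPDE Literature.Analysis.FluidPDE.BDSV

variable {u : UnitAddTorus (Fin 3) → EuclideanSpace ℝ (Fin 3)}


/-- Biot–Savart on `𝕋³` for divergence-free fields: `u - ∫u = -curl Δ⁻¹(curl u)`
(`Δ⁻¹Δu = u - ∫u`, `Δu = -curl curl u`, `Δ⁻¹ curl = curl Δ⁻¹`). [folklore] -/
private theorem sub_integral_eq_neg_curl_invLaplacian_curl (hu : IsSmooth u) (hdiv : IsDivFree u)
    (x : UnitAddTorus (Fin 3)) :
    u x - ∫ y, u y = -curl (invLaplacian (curl u)) x := by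
  have hlap : Torus.laplacian u = fun y => -curl (curl u) y := by
    funext y
    rw [curl_curl_of_isDivFree hu hdiv y, neg_neg]
  rw [← invLaplacian_laplacian hu x, hlap, ← invLaplacian_curl (isSmooth_curl hu) x]
  have hneg : (fun y => -curl (curl u) y) = -curl (curl u) := rfl
  rw [hneg, invLaplacian_neg (isSmooth_curl (isSmooth_curl hu))]
  rfl

/-- The velocity gradient through the vorticity: `∂ⱼu(x)ᵢ = -(curl (∂ⱼ Δ⁻¹ curl u)(x))ᵢ` for smooth
divergence-free `u` (differentiate `u - ∫u = -curl Δ⁻¹ curl u`; `∂ⱼ` commutes with `curl`). [folklore] -/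
private theorem partialDeriv_apply_eq_neg_curl (hu : IsSmooth u) (hdiv : IsDivFree u) (j i : Fin 3)
    (x : UnitAddTorus (Fin 3)) :
    Torus.partialDeriv j u x i = -(curl (Torus.partialDeriv j (invLaplacian (curl u))) x i) := by
  have hW : IsSmooth (invLaplacian (curl u)) := isSmooth_invLaplacian (isSmooth_curl hu)
  have hsub : Torus.partialDeriv j (fun y => u y - ∫ z, u z) x = Torus.partialDeriv j u x := by
    simp only [Torus.partialDeriv, Torus.lineDeriv, deriv_sub_const]
  have hfun : (fun y => u y - ∫ z, u z) = fun y => -curl (invLaplacian (curl u)) y := by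
    funext y
    exact sub_integral_eq_neg_curl_invLaplacian_curl hu hdiv y
  rw [← hsub, hfun, partialDeriv_neg, partialDeriv_curl hW j x]
  rfl

/-- `Δ⁻¹` acts componentwise: `(Δ⁻¹Z)_b = Δ⁻¹(Z_b)`. [folklore] -/
private theorem invLaplacian_apply_coord' {Z : UnitAddTorus (Fin 3) → EuclideanSpace ℝ (Fin 3)}
    (hZ : IsSmooth Z) (b : Fin 3) :
    (fun y => invLaplacian Z y b) = invLaplacian (fun y => Z y b) := by
  have h2 : (fun y => Z y b) = (EuclideanSpace.proj b : EuclideanSpace ℝ (Fin 3) →L[ℝ] ℝ) ∘ Z := rfl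
  rw [h2, invLaplacian_clm_comp hZ]
  rfl

/-- The Hessian entries of the vector potential are Hessians of scalar potentials:
`(∂ₐ∂ⱼ Δ⁻¹ω)(x)_b = ∂ₐ∂ⱼ(Δ⁻¹ω_b)(x)`. [folklore] -/
private theorem hessian_component_eq (hu : IsSmooth u) (j a b : Fin 3) :
    (fun x => Torus.partialDeriv a (Torus.partialDeriv j (invLaplacian (curl u))) x b) =
      Torus.partialDeriv a (Torus.partialDeriv j (invLaplacian (fun y => curl u y b))) := by
  have hω : IsSmooth (curl u) := isSmooth_curl hu
  have hW : IsSmooth (invLaplacian (curl u)) := isSmooth_invLaplacian hω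
  funext x
  rw [← partialDeriv_apply_coord ((hW.partialDeriv j).isContDiff (by simp)) a x b]
  congr 1
  funext y
  rw [← partialDeriv_apply_coord (hW.isContDiff (by simp)) j y b, invLaplacian_apply_coord' hω b]

/-- The vorticity components have zero mean: `∫ (curl u)_b = 0` (each is a difference of partial
derivatives of components of `u`). [folklore] -/
private theorem integral_curl_apply (hu : IsSmooth u) (b : Fin 3) : ∫ y, curl u y b = 0 := by
  have hint : ∀ j k : Fin 3, ∫ y, Torus.partialDeriv j u y k = 0 := fun j k => by
    have h := integral_partialDeriv_eq_zero_holds (hu.apply k) j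
    simp_rw [partialDeriv_apply_coord (hu.isContDiff (by simp))] at h
    exact h
  have hI : ∀ j k : Fin 3, Integrable (fun y => Torus.partialDeriv j u y k) volume := fun j k =>
    ((hu.partialDeriv j).apply k).integrable
  fin_cases b
  · show ∫ y, (Torus.partialDeriv 1 u y 2 - Torus.partialDeriv 2 u y 1) = 0
    rw [integral_sub (hI 1 2) (hI 2 1), hint, hint, sub_zero]
  · show ∫ y, (Torus.partialDeriv 2 u y 0 - Torus.partialDeriv 0 u y 2) = 0
    rw [integral_sub (hI 2 0) (hI 0 2), hint, hint, sub_zero]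
  · show ∫ y, (Torus.partialDeriv 0 u y 1 - Torus.partialDeriv 1 u y 0) = 0
    rw [integral_sub (hI 0 1) (hI 1 0), hint, hint, sub_zero]

/-- **`∇u` through `ω` with the constant threaded** (copy of `BDSV.exists_eLpNorm_partialDeriv_le_curl`
with the Hessian bound as a hypothesis): if `‖∂ⱼ∂ₖw‖_p ≤ C‖Δw‖_p` for all smooth scalar `w` on `𝕋³`
and all `j k`, then `‖x ↦ (∂ⱼu(x))ᵢ‖_p ≤ 2C ∑ₗ ‖(curl u)ₗ‖_p` for every smooth divergence-free `u`.
Search for candidate a priori estimates; no regularity claim. [cite: MajdaBertozziCUP2002, §11.1 eq. (11.9) with Prop. 10.6] -/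
theorem eLpNorm_partialDeriv_le_curl_of_hessian {p : ℝ≥0∞} (hp1 : 1 < p) {C : ℝ≥0}
    (hC : ∀ w : UnitAddTorus (Fin 3) → ℝ, IsSmooth w → ∀ j k : Fin 3,
      eLpNorm (Torus.partialDeriv j (Torus.partialDeriv k w)) p volume ≤
        (C : ℝ≥0∞) * eLpNorm (Torus.laplacian w) p volume)
    (u : UnitAddTorus (Fin 3) → EuclideanSpace ℝ (Fin 3)) (hu : IsSmooth u) (hdiv : IsDivFree u)
    (i j : Fin 3) :
    eLpNorm (fun x => Torus.partialDeriv j u x i) p volume ≤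
      ((2 * C : ℝ≥0) : ℝ≥0∞) * ∑ l : Fin 3, eLpNorm (fun x => curl u x l) p volume := by
  have hω : IsSmooth (curl u) := isSmooth_curl hu
  have hW : IsSmooth (invLaplacian (curl u)) := isSmooth_invLaplacian hω
  set S : ℝ≥0∞ := ∑ l : Fin 3, eLpNorm (fun x => curl u x l) p volume with hS
  -- the Hessian entries of the vector potential, `g a b = (∂ₐ∂ⱼΔ⁻¹ω)_b`
  set g : Fin 3 → Fin 3 → UnitAddTorus (Fin 3) → ℝ := fun a b x =>
    Torus.partialDeriv a (Torus.partialDeriv j (invLaplacian (curl u))) x b with hg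
  have hg_meas : ∀ a b, AEStronglyMeasurable (g a b) volume := fun a b =>
    (((hW.partialDeriv j).partialDeriv a).apply b).continuous.aestronglyMeasurable
  -- Calderón–Zygmund bound of each entry
  have hgb : ∀ a b, eLpNorm (g a b) p volume ≤ C * S := by
    intro a b
    have hωb : IsSmooth (fun y => curl u y b) := hω.apply b
    have hlap : Torus.laplacian (invLaplacian fun y => curl u y b) = fun y => curl u y b := by
      funext x
      rw [laplacian_invLaplacian hωb x, integral_curl_apply hu b, sub_zero]
    have h1 := hC (invLaplacian fun y => curl u y b) (isSmooth_invLaplacian hωb) a j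
    rw [hlap] at h1
    have hgeq : g a b = Torus.partialDeriv a (Torus.partialDeriv j (invLaplacian fun y => curl u y b)) :=
      hessian_component_eq hu j a b
    rw [hgeq]
    refine h1.trans ?_
    gcongr
    exact Finset.single_le_sum (f := fun l => eLpNorm (fun x => curl u x l) p volume)
      (fun _ _ => zero_le) (Finset.mem_univ b)
  -- differences of two entries
  have hdiff : ∀ a b, eLpNorm (fun x => g a b x - g b a x) p volume ≤ ((2 * C : ℝ≥0) : ℝ≥0∞) * S := by
    intro a b
    calc eLpNorm (fun x => g a b x - g b a x) p volume
        = eLpNorm (g a b - g b a) p volume := rfl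
      _ ≤ eLpNorm (g a b) p volume + eLpNorm (g b a) p volume :=
          eLpNorm_sub_le (hg_meas a b) (hg_meas b a) hp1.le
      _ ≤ C * S + C * S := add_le_add (hgb a b) (hgb b a)
      _ = ((2 * C : ℝ≥0) : ℝ≥0∞) * S := by push_cast; ring
  -- the curl of the differentiated potential in terms of the entries
  have hcomp : ∀ x (k : Fin 3), curl (Torus.partialDeriv j (invLaplacian (curl u))) x k =
      g (k + 1) (k + 2) x - g (k + 2) (k + 1) x := by
    intro x k
    fin_cases k
    · exact curl_apply_zero _ x
    · exact curl_apply_one _ x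
    · exact curl_apply_two _ x
  have hfun : (fun x => Torus.partialDeriv j u x i) = fun x => g (i + 2) (i + 1) x - g (i + 1) (i + 2) x := by
    funext x
    rw [partialDeriv_apply_eq_neg_curl hu hdiv j i x, hcomp x i]
    ring
  rw [hfun]
  exact hdiff (i + 2) (i + 1)

/-- **`2S` through `ω` with the constant threaded** (copy of `BDSV.exists_eLpNorm_twoStrain_le_curl`):
under the same Hessian hypothesis, `‖x ↦ (∂ᵢu(x))ⱼ + (∂ⱼu(x))ᵢ‖_p ≤ 4C ∑ₗ ‖(curl u)ₗ‖_p`.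
Search for candidate a priori estimates; no regularity claim. [cite: MajdaBertozziCUP2002, §11.1 eq. (11.9) with Prop. 10.6] -/
theorem eLpNorm_twoStrain_le_curl_of_hessian {p : ℝ≥0∞} (hp1 : 1 < p) {C : ℝ≥0}
    (hH : ∀ w : UnitAddTorus (Fin 3) → ℝ, IsSmooth w → ∀ j k : Fin 3,
      eLpNorm (Torus.partialDeriv j (Torus.partialDeriv k w)) p volume ≤
        (C : ℝ≥0∞) * eLpNorm (Torus.laplacian w) p volume)
    (u : UnitAddTorus (Fin 3) → EuclideanSpace ℝ (Fin 3)) (hu : IsSmooth u) (hdiv : IsDivFree u)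
    (i j : Fin 3) :
    eLpNorm (fun x => Torus.partialDeriv i u x j + Torus.partialDeriv j u x i) p volume ≤
      ((4 * C : ℝ≥0) : ℝ≥0∞) * ∑ l : Fin 3, eLpNorm (fun x => curl u x l) p volume := by
  have hC := eLpNorm_partialDeriv_le_curl_of_hessian hp1 hH
  have hmeas : ∀ a b : Fin 3, AEStronglyMeasurable (fun x => Torus.partialDeriv a u x b) volume :=
    fun a b => ((hu.partialDeriv a).apply b).continuous.aestronglyMeasurable
  calc eLpNorm (fun x => Torus.partialDeriv i u x j + Torus.partialDeriv j u x i) p volume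
      = eLpNorm ((fun x => Torus.partialDeriv i u x j) + fun x => Torus.partialDeriv j u x i)
          p volume := rfl
    _ ≤ eLpNorm (fun x => Torus.partialDeriv i u x j) p volume +
          eLpNorm (fun x => Torus.partialDeriv j u x i) p volume :=
        eLpNorm_add_le (hmeas i j) (hmeas j i) hp1.le
    _ ≤ ((2 * C : ℝ≥0) : ℝ≥0∞) * ∑ l : Fin 3, eLpNorm (fun x => curl u x l) p volume +
          ((2 * C : ℝ≥0) : ℝ≥0∞) * ∑ l : Fin 3, eLpNorm (fun x => curl u x l) p volume :=
        add_le_add (hC u hu hdiv j i) (hC u hu hdiv i j)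
    _ = ((4 * C : ℝ≥0) : ℝ≥0∞) * ∑ l : Fin 3, eLpNorm (fun x => curl u x l) p volume := by
        push_cast; ring

end ExplicitCZ

end Summit.NavierStokesRegularity.FunctionalMining

end
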